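import Summits.HubbardSuperconductivity.HubbardSuperconductivity.Theorems.NodalDiracTwistTwistCalibrationBdGLocus
import Summits.HubbardSuperconductivity.HubbardSuperconductivity.Theorems.NodalDiracTwistTwistCalibrationBdGOverlap
import Summits.HubbardSuperconductivity.HubbardSuperconductivity.Theorems.NodalDiracTwistTwistCalibrationBdGHolonomyMesh
import Summits.HubbardSuperconductivity.HubbardSuperconductivity.Theorems.NodalDiracTwistTwistCalibrationBdGHolonomyNodal

/-!
# Route `NodalDiracTwist` — support `TwistCalibrationBdG`: holonomy `-1` (second clause)

For stmt-HubbardSuperconductivity-1625: assembly of the SECOND CLAUSE (`holonomy_re_prod_neg`). Off the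
degeneracy locus the sector ground state of the `U = 0` sourced spin-twisted family is the BCS state
`Vᴴ_φ e_{D↓}` up to a unit phase (`eq_smul_bcs_of_forall_twistNambuZ_ne_zero`, no zero mode on the loop
by `twistNambuZ_loopPt_ne_zero`); the phases cancel around the cycle; the overlaps factorise over blocks
(`star_bcs_dotProduct_bcs`), so the real part of the cyclic product is the product over site labels of
the cyclic overlap products of the lower Bogoliubov spinors; by the sign-transfer identity and the mesh
lemmas each regular block contributes a positive factor and the unique critical block (uniqueness:
`eq_of_cos_grid_eq_cos_grid`) a negative one (`exists_mesh_block_sign`).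

Sources: Hatsugai, J. Phys. Soc. Jpn. 75 (2006) 123601; Fukui–Hatsugai–Suzuki (2005); de Gennes (1966)
Ch. 5. No definitions.
-/

-- the mandated namespace `Summit.<Summit>.<Problem>.Theorems` repeats `HubbardSuperconductivity`
-- (single-problem summit, D-0017), which the `dupNamespace` linter flags on every declaration
set_option linter.dupNamespace false

namespace Summit.HubbardSuperconductivity.HubbardSuperconductivity.Theorems.NodalDiracTwist

open Matrix Finset Complex Literature.Probability.LatticeModels Literature.MathematicalPhysics.QuantumLattice
open scoped ComplexConjugate

variable {L : ℕ} [NeZero L]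

/-! ## Part III (b): the holonomy `-1` around each quartet point -/

section Holonomy

/-- The principal-root vector `p₋(w)` agrees up to sign with `i s/|s|` for ANY square root `s` of
`w ≠ 0`. [folklore] -/
theorem nambuLower_eq_or_eq_neg {w s : ℂ} (hw : w ≠ 0) (hs : s ^ 2 = w) :
    nambuLower w = Complex.I * s / (‖s‖ : ℂ) ∨ nambuLower w = -(Complex.I * s / (‖s‖ : ℂ)) := by
  unfold nambuLower
  rw [if_neg hw]
  have h0 : (w ^ (2⁻¹ : ℂ)) ^ 2 = s ^ 2 := by rw [Complex.cpow_ofNat_inv_pow, hs]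
  rcases sq_eq_sq_iff_eq_or_eq_neg.mp h0 with h1 | h1
  · left; rw [h1]
  · right; rw [h1, norm_neg]; ring

/-- Two site labels whose shifted grid momenta both hit the node coincide: at a quartet point the
critical block is unique (`|p_μ| = c ∈ (0, π)` excludes the reflected solution). [folklore] -/
theorem eq_of_cos_grid_eq_cos_grid {c κ q : ℝ} (hc0 : 0 < c) (hcπ : c < Real.pi) (hq : |q| = c)
    {v v' : ℕ} (hv : v < L) (hv' : v' < L)
    (h1 : Real.cos (2 * Real.pi * v / L + q / L) = Real.cos κ)
    (h2 : Real.cos (2 * Real.pi * v' / L + q / L) = Real.cos κ) : v = v' := by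
  have hL : (L : ℝ) ≠ 0 := Nat.cast_ne_zero.mpr (NeZero.ne L)
  have hL0 : (0 : ℝ) < L := Nat.cast_pos.mpr (Nat.pos_of_ne_zero (NeZero.ne L))
  have hpi := Real.pi_pos
  rw [← h2, Real.cos_eq_cos_iff] at h1
  obtain ⟨j, hj | hj⟩ := h1
  · -- `2π v'/L = 2jπ + 2π v/L`: `v' = v + jL`
    have h3 : (v' : ℝ) = v + j * L := by
      field_simp at hj
      nlinarith [hj]
    have h4 : (v' : ℤ) = v + j * L := by exact_mod_cast h3
    have : j = 0 := by
      rcases lt_trichotomy j 0 with h5 | h5 | h5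
      · have : (v' : ℤ) < 0 := by nlinarith
        omega
      · exact h5
      · have : (L : ℤ) ≤ v' := by nlinarith
        omega
    subst this
    simp at h4
    omega
  · -- `2π v'/L + q/L = 2jπ - (2π v/L + q/L)`: `q ∈ πℤ`, impossible
    exfalso
    have h3 : q = (j * L - v - v' : ℝ) * Real.pi := by
      field_simp at hj
      nlinarith [hj]
    have hm : ∃ m : ℤ, q = m * Real.pi := ⟨j * L - v - v', by rw [h3]; push_cast; ring⟩
    obtain ⟨m, hm⟩ := hm
    have hmabs : |q| = |(m : ℝ)| * Real.pi := by rw [hm, abs_mul, abs_of_pos hpi]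
    rw [hq] at hmabs
    rcases lt_trichotomy m 0 with h5 | h5 | h5
    · have : (m : ℝ) ≤ -1 := by exact_mod_cast Int.le_sub_one_of_lt h5
      have : |(m : ℝ)| ≥ 1 := by rw [abs_of_neg (by linarith)]; linarith
      nlinarith
    · subst h5; simp at hmabs; linarith
    · have : (1 : ℝ) ≤ m := by exact_mod_cast h5
      have : |(m : ℝ)| ≥ 1 := by rw [abs_of_pos (by linarith)]; linarith
      nlinarith

/-- **The block products have the right signs.** Around a quartet point `p`, for every site label `x`
and all fine meshes, the cyclic overlap product of the lower Bogoliubov spinors of the block `x̄` along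
the loop is NEGATIVE if the block is critical at `p` and POSITIVE otherwise. [folklore] -/
theorem exists_mesh_block_sign {μ₀ h κ c r : ℝ} {p : Fin 2 → ℝ} (hh : h ≠ 0) (hκ : Real.cos κ = -μ₀ / 4)
    (hκ0 : 0 < κ) (hκπ : κ < Real.pi) (hc0 : 0 < c) (hcπ : c < Real.pi)
    (hcos : Real.cos c = Real.cos (L * κ)) (hp0 : |p 0| = c) (hp1 : |p 1| = c) (hr0 : 0 < r)
    (hr : r < min c (Real.pi - c)) (x : FermionTorus 2 L) :
    ∃ n₀ : ℕ, ∀ n ≥ n₀,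
      let B : ℝ := ∏ i : Fin n, ((starRingEnd ℂ)
          (nambuLower (twistNambuZ L μ₀ h (fun ν : Fin 2 => p ν + r *
            (if ν = 0 then Real.cos (2 * Real.pi * (i : ℕ) / n) else Real.sin (2 * Real.pi * (i : ℕ) / n)))
            x.toTorusSite)) *
          nambuLower (twistNambuZ L μ₀ h (fun ν : Fin 2 => p ν + r *
            (if ν = 0 then Real.cos (2 * Real.pi * ((finRotate n i : ℕ)) / n)
              else Real.sin (2 * Real.pi * ((finRotate n i : ℕ)) / n))) x.toTorusSite)).re
      (Real.cos (latticeMomentum L x.toTorusSite 0 + p 0 / L) = Real.cos κ ∧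
          Real.cos (latticeMomentum L x.toTorusSite 1 + p 1 / L) = Real.cos κ → B < 0) ∧
      (¬ (Real.cos (latticeMomentum L x.toTorusSite 0 + p 0 / L) = Real.cos κ ∧
          Real.cos (latticeMomentum L x.toTorusSite 1 + p 1 / L) = Real.cos κ) → 0 < B) := by
  set Z : ℝ → ℂ := fun θ => twistNambuZ L μ₀ h
    (fun ν : Fin 2 => p ν + r * (if ν = 0 then Real.cos θ else Real.sin θ)) x.toTorusSite with hZ
  have hZc : Continuous Z := continuous_twistNambuZ_loopPt hκ x.toTorusSite
  have hZper : ∀ θ, Z (θ + 2 * Real.pi) = Z θ := fun θ => twistNambuZ_loopPt_periodic x.toTorusSite θ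
  have hZ0 : ∀ θ, Z θ ≠ 0 := fun θ =>
    twistNambuZ_loopPt_ne_zero hh hκ hc0 hcπ hcos hp0 hp1 hr0 hr x.toTorusSite θ
  -- transfer of the sign from any choice of square roots
  have transfer : ∀ (n : ℕ) (s : Fin n → ℂ), (∀ i, s i ^ 2 = Z (2 * Real.pi * (i : ℕ) / n)) →
      ∏ i : Fin n, ((starRingEnd ℂ) (nambuLower (Z (2 * Real.pi * (i : ℕ) / n))) *
          nambuLower (Z (2 * Real.pi * ((finRotate n i : ℕ)) / n))).re =
        (∏ i, ((starRingEnd ℂ) (s i) * s (finRotate n i)).re) / (∏ i, ‖s i‖) ^ 2 ∧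
      0 < (∏ i : Fin n, ‖s i‖) ^ 2 := by
    intro n s hs
    constructor
    · exact prod_re_conj_mul_finRotate_eq (fun i => nambuLower (Z (2 * Real.pi * (i : ℕ) / n))) s
        (fun i => nambuLower_eq_or_eq_neg (hZ0 _) (hs i))
    · apply pow_pos
      apply Finset.prod_pos
      intro i _
      apply norm_pos_iff.mpr
      intro h0
      apply hZ0 (2 * Real.pi * (i : ℕ) / n)
      rw [← hs i, h0]; ring
  by_cases hnod : Real.cos (latticeMomentum L x.toTorusSite 0 + p 0 / L) = Real.cos κ ∧
      Real.cos (latticeMomentum L x.toTorusSite 1 + p 1 / L) = Real.cos κ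
  · -- critical block: winding curve, holonomy `-1`
    obtain ⟨d, hd, σ, hσ, hR₂, hR₁, hH0, hHπ⟩ := nodal_chart_hypotheses hh hκ hκ0 hκπ hc0 hcπ hcos hp0 hp1
      hr0 hr x.toTorusSite hnod.1 hnod.2
    obtain ⟨c₁, c₂, h1sq, h2sq, h1c, h2c, ε₁, ε₂, hε, hP₁, hP₂⟩ := exists_sqrt_charts d hd
    obtain ⟨n₀, hn₀⟩ := exists_mesh_prod_neg hZc hZper hZ0 h1sq h2sq h1c h2c hε hP₁ hP₂ hR₂ hR₁ hσ hH0 hHπ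
    refine ⟨n₀, fun n hn => ⟨fun _ => ?_, fun h' => absurd hnod h'⟩⟩
    obtain ⟨s, hs, hprod⟩ := hn₀ n hn
    obtain ⟨heq, hpos⟩ := transfer n s hs
    change ∏ i : Fin n, ((starRingEnd ℂ) (nambuLower (Z (2 * Real.pi * (i : ℕ) / n))) *
          nambuLower (Z (2 * Real.pi * ((finRotate n i : ℕ)) / n))).re < 0
    rw [heq]
    exact div_neg_of_neg_of_pos hprod hpos
  · -- regular block: a continuous square root along the whole loop, holonomy `+1`
    obtain ⟨d, hd, havoid⟩ := exists_ray_not_mem_of_regular hh hκ hc0 hcπ hcos hp0 hp1 hr0 hr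
      x.toTorusSite hnod
    obtain ⟨c₁, c₂, -, h2sq, -, h2c, -⟩ := exists_sqrt_charts d hd
    obtain ⟨n₀, hn₀⟩ := exists_mesh_prod_pos hZc hZper hZ0 h2sq (fun θ => h2c _ (havoid θ))
    refine ⟨n₀, fun n hn => ⟨fun h' => absurd h' hnod, fun _ => ?_⟩⟩
    obtain ⟨s, hs, hprod⟩ := hn₀ n hn
    obtain ⟨heq, hpos⟩ := transfer n s hs
    change 0 < ∏ i : Fin n, ((starRingEnd ℂ) (nambuLower (Z (2 * Real.pi * (i : ℕ) / n))) *
          nambuLower (Z (2 * Real.pi * ((finRotate n i : ℕ)) / n))).re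
    rw [heq]
    exact div_pos hprod hpos

/-- **Holonomy `-1` (`TwistCalibrationBdG`, second clause).** Around each point of the diagonal
quartet `(±c, ±c)`, for every loop radius `0 < r < min(c, π - c)` and all fine discretisations of the
loop, the cyclic overlap product of arbitrary normalised sector ground states of the `U = 0` sourced
spin-twisted family at the loop points has NEGATIVE real part: the ground state changes sign when the
node is encircled. Proof: off the locus the sector ground state is the BCS state `Vᴴ_φ e_{D↓}` up to
a phase (phases cancel cyclically); its overlaps factorise over blocks (`star_bcs_dotProduct_bcs`);
every regular block contributes a positive cyclic product and the unique critical block a negative one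
(`exists_mesh_block_sign`). Hatsugai (2006) (quantised Berry phase `π` of a real bundle);
de Gennes (1966) Ch. 5. [folklore] -/
theorem holonomy_re_prod_neg {μ₀ h : ℝ} (hμ₁ : -4 < μ₀) (hμ₂ : μ₀ < 4) (hh : h ≠ 0)
    {c : ℝ} (hc0 : 0 < c) (hcπ : c < Real.pi)
    (hcos : Real.cos c = Real.cos (L * Real.arccos (-μ₀ / 4))) {p : Fin 2 → ℝ}
    (hp0 : |p 0| = c) (hp1 : |p 1| = c) {r : ℝ} (hr0 : 0 < r) (hr : r < min c (Real.pi - c)) :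
    let K := LinearMap.ker (Matrix.toLin' (HubbardWave0.spinZ :
      Matrix (Finset (Orb (FermionTorus 2 L))) (Finset (Orb (FermionTorus 2 L))) ℂ))
    let H := sourcedSpinTwistedHubbardTorus L 0 μ₀ h
    ∃ n₀ : ℕ, ∀ n ≥ n₀, ∀ ψ : Fin n → Fock (Orb (FermionTorus 2 L)),
      (∀ i : Fin n, ((ψ i) ∈ K ∧ (ψ i) ≠ 0 ∧
        H (fun ν : Fin 2 => p ν + r * (if ν = 0 then Real.cos (2 * Real.pi * (i : ℕ) / n)
          else Real.sin (2 * Real.pi * (i : ℕ) / n))) *ᵥ (ψ i) =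
        (((H (fun ν : Fin 2 => p ν + r * (if ν = 0 then Real.cos (2 * Real.pi * (i : ℕ) / n)
          else Real.sin (2 * Real.pi * (i : ℕ) / n)))).minEnergyOn K : ℝ) : ℂ) • (ψ i)) ∧
        star (ψ i) ⬝ᵥ ψ i = 1) →
      (∏ i : Fin n, star (ψ i) ⬝ᵥ ψ (finRotate n i)).re < 0 := by
  intro K H
  have hpi := Real.pi_pos
  set κ : ℝ := Real.arccos (-μ₀ / 4) with hκdef
  have hκ : Real.cos κ = -μ₀ / 4 := Real.cos_arccos (by linarith) (by linarith)
  have hκ0 : 0 < κ := Real.arccos_pos.mpr (by linarith)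
  have hκπ : κ < Real.pi := Real.arccos_lt_pi.mpr (by linarith)
  -- the per-block mesh
  choose nb hnb using fun x : FermionTorus 2 L =>
    exists_mesh_block_sign (L := L) hh hκ hκ0 hκπ hc0 hcπ hcos hp0 hp1 hr0 hr x
  -- the critical block: existence and uniqueness
  have hcellp : ∀ μ : Fin 2, |p μ| = c → p μ ∈ Set.Ioc (-Real.pi) Real.pi := by
    intro μ hμ
    have := abs_le.mp hμ.le
    exact ⟨by linarith, by linarith⟩
  obtain ⟨k₀, hk₀⟩ := (exists_twistNambuZ_eq_zero_iff (L := L) hμ₁ hμ₂ hh hc0.le hcπ.le hcos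
    (hcellp 0 hp0) (hcellp 1 hp1)).mpr ⟨hp0, hp1⟩
  set x₀ : FermionTorus 2 L := FermionTorus.ofTorusSite k₀ with hx₀
  have hx₀nod : Real.cos (latticeMomentum L x₀.toTorusSite 0 + p 0 / L) = Real.cos κ ∧
      Real.cos (latticeMomentum L x₀.toTorusSite 1 + p 1 / L) = Real.cos κ := by
    rw [hx₀, FermionTorus.toTorusSite_ofTorusSite]
    have := (twistNambuZ_eq_zero_iff (L := L) hh p k₀).mp hk₀
    rw [hκ]; exact this
  have huniq : ∀ x : FermionTorus 2 L,
      (Real.cos (latticeMomentum L x.toTorusSite 0 + p 0 / L) = Real.cos κ ∧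
        Real.cos (latticeMomentum L x.toTorusSite 1 + p 1 / L) = Real.cos κ) → x = x₀ := by
    intro x hx
    have hk : x.toTorusSite = x₀.toTorusSite := by
      funext μ
      apply ZMod.val_injective
      fin_cases μ
      · exact eq_of_cos_grid_eq_cos_grid (L := L) hc0 hcπ hp0 (ZMod.val_lt _) (ZMod.val_lt _)
          (by simpa [latticeMomentum] using hx.1) (by simpa [latticeMomentum] using hx₀nod.1)
      · exact eq_of_cos_grid_eq_cos_grid (L := L) hc0 hcπ hp1 (ZMod.val_lt _) (ZMod.val_lt _)
          (by simpa [latticeMomentum] using hx.2) (by simpa [latticeMomentum] using hx₀nod.2)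
    exact (FermionTorus.equivTorusSite (d := 2) (L := L)).injective hk
  refine ⟨Finset.univ.sup nb, fun n hn ψ hψ => ?_⟩
  have hnb' : ∀ x, nb x ≤ n := fun x => le_trans (Finset.le_sup (Finset.mem_univ x)) hn
  -- abbreviations
  set φ : Fin n → Fin 2 → ℝ := fun i ν => p ν + r * (if ν = 0 then Real.cos (2 * Real.pi * (i : ℕ) / n)
    else Real.sin (2 * Real.pi * (i : ℕ) / n)) with hφ
  set ψ₀ : Fin n → Fock (Orb (FermionTorus 2 L)) := fun i =>
    (bdgV L μ₀ h (φ i))ᴴ *ᵥ (Pi.single spinDownOrbitals 1 : Fock (Orb (FermionTorus 2 L))) with hψ₀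
  set a : Fin n → ℂ := fun i => (bdgV L μ₀ h (φ i) *ᵥ ψ i) spinDownOrbitals with ha
  -- the ground states on the loop are phases times the BCS states
  have hz : ∀ (i : Fin n) (x : FermionTorus 2 L), twistNambuZ L μ₀ h (φ i) x.toTorusSite ≠ 0 :=
    fun i x => twistNambuZ_loopPt_ne_zero hh hκ hc0 hcπ hcos hp0 hp1 hr0 hr x.toTorusSite _
  have hψeq : ∀ i, ψ i = a i • ψ₀ i := by
    intro i
    obtain ⟨⟨-, -, hHi⟩, -⟩ := hψ i
    have hHi' : sourcedSpinTwistedHubbardTorus L 0 μ₀ h (φ i) *ᵥ ψ i =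
        ((((∑ o' ∈ (spinDownOrbitals : Finset (Orb (FermionTorus 2 L))), bdgModeEnergy L μ₀ h (φ i) o') +
          ∑ k : TorusSite 2 L, twistXi L μ₀ (φ i) k : ℝ)) : ℂ) • ψ i := by
      rw [← minEnergyOn_sourcedSpinTwisted_ker_spinZ]; exact hHi
    exact eq_smul_bcs_of_forall_twistNambuZ_ne_zero (hz i) hHi'
  have hanorm : ∀ i, (starRingEnd ℂ) (a i) * a i = 1 := by
    intro i
    obtain ⟨-, hni⟩ := hψ i
    rw [hψeq i, star_smul_dotProduct_smul] at hni
    simp only [hψ₀] at hni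
    rw [star_bdgV_conjTranspose_single_dotProduct, if_pos rfl, mul_one, Complex.star_def] at hni
    exact hni
  -- the factors of the cyclic product
  have hfac : ∀ i, star (ψ i) ⬝ᵥ ψ (finRotate n i) = (starRingEnd ℂ) (a i) * a (finRotate n i) *
      ∏ x : FermionTorus 2 L, ((((starRingEnd ℂ) (nambuLower (twistNambuZ L μ₀ h (φ i) x.toTorusSite)) *
        nambuLower (twistNambuZ L μ₀ h (φ (finRotate n i)) x.toTorusSite)).re : ℝ) : ℂ) := by
    intro i
    rw [hψeq i, hψeq (finRotate n i), star_smul_dotProduct_smul, Complex.star_def]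
    simp only [hψ₀]
    rw [star_bcs_dotProduct_bcs]
  -- the phases cancel around the cycle
  have hphase : (∏ i, (starRingEnd ℂ) (a i)) * ∏ i, a (finRotate n i) = 1 := by
    rw [Equiv.prod_comp (finRotate n) a, ← Finset.prod_mul_distrib]
    exact Finset.prod_eq_one fun i _ => hanorm i
  -- the cyclic product is the product of the block products
  have hprod : ∏ i, star (ψ i) ⬝ᵥ ψ (finRotate n i) =
      ((∏ x : FermionTorus 2 L, ∏ i : Fin n, ((starRingEnd ℂ)
          (nambuLower (twistNambuZ L μ₀ h (φ i) x.toTorusSite)) *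
          nambuLower (twistNambuZ L μ₀ h (φ (finRotate n i)) x.toTorusSite)).re : ℝ) : ℂ) := by
    simp only [hfac, Finset.prod_mul_distrib]
    rw [hphase, one_mul, Finset.prod_comm]
    push_cast
    rfl
  rw [hprod, Complex.ofReal_re]
  -- signs of the block products
  have hB : ∀ x : FermionTorus 2 L,
      let B : ℝ := ∏ i : Fin n, ((starRingEnd ℂ) (nambuLower (twistNambuZ L μ₀ h (φ i) x.toTorusSite)) *
        nambuLower (twistNambuZ L μ₀ h (φ (finRotate n i)) x.toTorusSite)).re
      (x = x₀ → B < 0) ∧ (x ≠ x₀ → 0 < B) := by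
    intro x
    obtain ⟨h1, h2⟩ := hnb x n (hnb' x)
    constructor
    · intro hx; subst hx; exact h1 hx₀nod
    · intro hx; exact h2 fun h' => hx (huniq x h')
  rw [← Finset.mul_prod_erase _ _ (Finset.mem_univ x₀)]
  apply mul_neg_of_neg_of_pos ((hB x₀).1 rfl)
  exact Finset.prod_pos fun x hx => (hB x).2 (Finset.ne_of_mem_erase hx)

end Holonomy

end Summit.HubbardSuperconductivity.HubbardSuperconductivity.Theorems.NodalDiracTwist
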